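import Mathlib.MeasureTheory.Function.L2Space
import Mathlib.Analysis.InnerProductSpace.Projection.Basic
import Mathlib.MeasureTheory.Measure.CharacteristicFunction.Basic
import Mathlib.MeasureTheory.Function.AEEqOfLIntegral
import Mathlib.Analysis.SpecialFunctions.Trigonometric.Basic
import HarnessLib

/-!
# Trigonometric polynomials are dense in `L²` of a finite measure on `ℝ^J`

Theorem-only file (no definitions, no named facts).  For a FINITE Borel measure `ν` on `J → ℝ` (`J` finite) — no moment, density or regularity
assumption — the real trigonometric polynomials `Σ_k (α_k cos(Σ_j t_{kj}v_j) + β_k sin(Σ_j t_{kj}v_j))` are dense in `L²(ν)`: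

* `ae_eq_zero_of_forall_integral_mul_cos_sin_eq_zero` — if `h ∈ L¹(ν)` is measurable and `∫ h·cos(t·v) dν = ∫ h·sin(t·v) dν = 0` for all `t ∈ ℝ^J`, then
  `h = 0` a.e.  Proof (the characteristic-function proof of Janson 1997 Thm. 2.6, without any power series): the finite measures `h⁺ν` and `h⁻ν` have the same
  characteristic function `L ↦ ∫ e^{iL(v)}` (every linear functional on `ℝ^J` is `v ↦ Σ_j t_j v_j`), hence coincide (Mathlib `Measure.ext_of_charFunDual`), so
  `h⁺ = h⁻` a.e.;
* `exists_trigPoly_sub_eLpNorm_lt` — for `g ∈ L²(ν)` and `ε > 0` there are `n`, frequencies `t_k ∈ ℝ^J` and coefficients `α_k, β_k` with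
  `‖g − Σ_k (α_k cos(t_k·) + β_k sin(t_k·))‖_{L²(ν)} < ε` (orthogonal complement of the span `= ⊥` ⇒ dense, in the Hilbert space `Lp ℝ 2 ν`).

This is the density step behind «the exponential algebra generates `L²`» in the Osterwalder–Schrader reconstruction (Glimm–Jaffe 1987 §6.1, the algebra `𝓔`
of exponentials `e^{iφ(f)}`), used by `Summits/QuantumFields/YangMills/Theorems/BalabanUVNodesN15KingModel…` to feed the tree's `gapNorm_le_exp_of_dense_clustering`.

## References
* S. Janson, *Gaussian Hilbert Spaces* (1997), Theorem 2.6 (proof: `h⁺ν`, `h⁻ν` have equal characteristic functions). [Janson1997]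
* J. Glimm, A. Jaffe, *Quantum Physics* (2nd ed. 1987), §6.1 (the exponential algebra). [GlimmJaffe1987]

Mathlib: `charFunDual`, `Measure.ext_of_charFunDual`, `integral_withDensity_eq_integral_toReal_smul₀`, `withDensity_eq_iff`, `LinearMap.pi_apply_eq_sum_univ`,
`Submodule.topologicalClosure_eq_top_iff`, `Submodule.mem_span_iff_exists_finset_subset`, `L2.inner_def`, `Lp.norm_toLp`.
-/

open MeasureTheory Filter Topology Finset Complex
open scoped InnerProductSpace ENNReal

namespace Literature.Probability.Distributions

noncomputable section

variable {J : Type*} [Fintype J]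

/-! ### Vanishing of all trigonometric moments forces vanishing -/

/-- A continuous linear functional on `ℝ^J` is `v ↦ Σ_j t_j v_j` with `t_j = L(e_j)`. [folklore] -/
private theorem strongDual_apply_eq_sum [DecidableEq J] (L : StrongDual ℝ (J → ℝ)) (v : J → ℝ) :
    L v = ∑ j, (L fun k => if j = k then 1 else 0) * v j := by
  have h := LinearMap.pi_apply_eq_sum_univ L.toLinearMap v
  simp only [ContinuousLinearMap.coe_coe, smul_eq_mul] at h
  rw [h]
  exact Finset.sum_congr rfl fun j _ => mul_comm _ _

/-- The characteristic function of `wν` (`0 ≤ w`, `w ∈ L¹(ν)`): `∫ e^{iL(v)} d(wν) = ∫ w cos(L·) dν + i∫ w sin(L·) dν`. [cite: Janson1997, Thm 2.6 (proof)] -/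
theorem charFunDual_withDensity_eq {ν : Measure (J → ℝ)} {w : (J → ℝ) → ℝ} (hwm : Measurable w) (hw0 : ∀ v, 0 ≤ w v) (hwi : Integrable w ν)
    (L : StrongDual ℝ (J → ℝ)) :
    charFunDual (ν.withDensity fun v => ENNReal.ofReal (w v)) L
      = ((∫ v, w v * Real.cos (L v) ∂ν : ℝ) : ℂ) + ((∫ v, w v * Real.sin (L v) ∂ν : ℝ) : ℂ) * I := by
  rw [charFunDual_apply, integral_withDensity_eq_integral_toReal_smul₀ hwm.ennreal_ofReal.aemeasurable (ae_of_all _ fun v => ENNReal.ofReal_lt_top)]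
  have hpt : ∀ v, (ENNReal.ofReal (w v)).toReal • cexp ((L v : ℂ) * I) = ((w v * Real.cos (L v) : ℝ) : ℂ) + ((w v * Real.sin (L v) : ℝ) : ℂ) * I := by
    intro v
    rw [ENNReal.toReal_ofReal (hw0 v), real_smul, Complex.exp_mul_I, ← Complex.ofReal_cos, ← Complex.ofReal_sin]
    push_cast
    ring
  simp_rw [hpt]
  have hbd : ∀ (φ : ℝ → ℝ), Continuous φ → (∀ x, |φ x| ≤ 1) → Integrable (fun v => w v * φ (L v)) ν := fun φ hφ hφ1 =>
    hwi.norm.mono' (hwm.mul (hφ.measurable.comp L.continuous.measurable)).aestronglyMeasurable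
      (ae_of_all _ fun v => by
        rw [norm_mul]
        exact mul_le_of_le_one_right (norm_nonneg _) (by rw [Real.norm_eq_abs]; exact hφ1 _))
  have h1 : Integrable (fun v => ((w v * Real.cos (L v) : ℝ) : ℂ)) ν := (hbd Real.cos Real.continuous_cos Real.abs_cos_le_one).ofReal
  have h2 : Integrable (fun v => ((w v * Real.sin (L v) : ℝ) : ℂ) * I) ν :=
    (hbd Real.sin Real.continuous_sin Real.abs_sin_le_one).ofReal.mul_const I
  rw [integral_add h1 h2, integral_mul_const, integral_complex_ofReal, integral_complex_ofReal]

/-- ★ **VANISHING OF ALL TRIGONOMETRIC MOMENTS FORCES VANISHING** (finite measure `ν` on `ℝ^J`, no moment assumptions): if `h ∈ L¹(ν)` is measurable and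
`∫ h(v)cos(Σ_j t_j v_j) dν = ∫ h(v)sin(Σ_j t_j v_j) dν = 0` for every `t ∈ ℝ^J`, then `h = 0` `ν`-a.e. (`h⁺ν` and `h⁻ν` have the same characteristic function.)
[cite: Janson1997, Thm 2.6 (proof)] -/
theorem ae_eq_zero_of_forall_integral_mul_cos_sin_eq_zero {ν : Measure (J → ℝ)} [IsFiniteMeasure ν] {h : (J → ℝ) → ℝ} (hhm : Measurable h)
    (hh : Integrable h ν)
    (hcos : ∀ t : J → ℝ, ∫ v, h v * Real.cos (∑ j, t j * v j) ∂ν = 0) (hsin : ∀ t : J → ℝ, ∫ v, h v * Real.sin (∑ j, t j * v j) ∂ν = 0) :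
    h =ᵐ[ν] 0 := by
  classical
  -- every linear functional is a frequency
  have hcosL : ∀ L : StrongDual ℝ (J → ℝ), ∫ v, h v * Real.cos (L v) ∂ν = 0 := fun L => by
    have e : (fun v => h v * Real.cos (L v)) = fun v => h v * Real.cos (∑ j, (L fun k => if j = k then 1 else 0) * v j) := by
      funext v; rw [strongDual_apply_eq_sum]
    rw [e]; exact hcos _
  have hsinL : ∀ L : StrongDual ℝ (J → ℝ), ∫ v, h v * Real.sin (L v) ∂ν = 0 := fun L => by
    have e : (fun v => h v * Real.sin (L v)) = fun v => h v * Real.sin (∑ j, (L fun k => if j = k then 1 else 0) * v j) := by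
      funext v; rw [strongDual_apply_eq_sum]
    rw [e]; exact hsin _
  -- positive and negative parts
  set hp : (J → ℝ) → ℝ := fun v => max (h v) 0 with hhp
  set hm : (J → ℝ) → ℝ := fun v => max (-h v) 0 with hhm'
  have hpm : Measurable hp := hhm.max measurable_const
  have hmm : Measurable hm := hhm.neg.max measurable_const
  have hp0 : ∀ v, 0 ≤ hp v := fun v => le_max_right _ _
  have hm0 : ∀ v, 0 ≤ hm v := fun v => le_max_right _ _
  have hph : ∀ v, hp v ≤ |h v| := fun v => max_le (le_abs_self _) (abs_nonneg _)
  have hmh : ∀ v, hm v ≤ |h v| := fun v => max_le (neg_le_abs _) (abs_nonneg _)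
  have hsub : ∀ v, hp v - hm v = h v := fun v => by
    simp only [hhp, hhm']
    rcases le_total 0 (h v) with h0 | h0
    · rw [max_eq_left h0, max_eq_right (by linarith), sub_zero]
    · rw [max_eq_right h0, max_eq_left (by linarith)]; ring
  have hIp : Integrable hp ν :=
    hh.norm.mono' hpm.aestronglyMeasurable (ae_of_all _ fun v => by rw [Real.norm_eq_abs, abs_of_nonneg (hp0 v), Real.norm_eq_abs]; exact hph v)
  have hIm : Integrable hm ν :=
    hh.norm.mono' hmm.aestronglyMeasurable (ae_of_all _ fun v => by rw [Real.norm_eq_abs, abs_of_nonneg (hm0 v), Real.norm_eq_abs]; exact hmh v)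
  -- equal trigonometric moments of `hp` and `hm`
  have htrig : ∀ (L : StrongDual ℝ (J → ℝ)) (φ : ℝ → ℝ), Continuous φ → (∀ x, |φ x| ≤ 1) → ∫ v, h v * φ (L v) ∂ν = 0 →
      ∫ v, hp v * φ (L v) ∂ν = ∫ v, hm v * φ (L v) ∂ν := by
    intro L φ hφ hφ1 h0
    have hint : ∀ w : (J → ℝ) → ℝ, Measurable w → Integrable w ν → Integrable (fun v => w v * φ (L v)) ν := fun w hwm hwi =>
      hwi.norm.mono' (hwm.mul (hφ.measurable.comp L.continuous.measurable)).aestronglyMeasurable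
        (ae_of_all _ fun v => by
          rw [norm_mul]
          exact mul_le_of_le_one_right (norm_nonneg _) (by rw [Real.norm_eq_abs]; exact hφ1 _))
    have hdiff : ∫ v, hp v * φ (L v) ∂ν - ∫ v, hm v * φ (L v) ∂ν = 0 := by
      rw [← integral_sub (hint hp hpm hIp) (hint hm hmm hIm), ← h0]
      refine integral_congr_ae (ae_of_all _ fun v => ?_)
      simp only [← sub_mul, hsub]
    linarith
  -- equal characteristic functions
  set μp := ν.withDensity fun v => ENNReal.ofReal (hp v) with hμp
  set μm := ν.withDensity fun v => ENNReal.ofReal (hm v) with hμm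
  haveI : IsFiniteMeasure μp := isFiniteMeasure_withDensity_ofReal hIp.hasFiniteIntegral
  haveI : IsFiniteMeasure μm := isFiniteMeasure_withDensity_ofReal hIm.hasFiniteIntegral
  have hchar : charFunDual μp = charFunDual μm := by
    funext L
    rw [hμp, hμm, charFunDual_withDensity_eq hpm hp0 hIp L, charFunDual_withDensity_eq hmm hm0 hIm L,
      htrig L Real.cos Real.continuous_cos Real.abs_cos_le_one (hcosL L), htrig L Real.sin Real.continuous_sin Real.abs_sin_le_one (hsinL L)]
  have hμ : μp = μm := Measure.ext_of_charFunDual hchar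
  -- hence `hp = hm` a.e.
  have hae : (fun v => ENNReal.ofReal (hp v)) =ᵐ[ν] fun v => ENNReal.ofReal (hm v) := by
    refine (withDensity_eq_iff hpm.ennreal_ofReal.aemeasurable hmm.ennreal_ofReal.aemeasurable ?_).1 hμ
    exact (lintegral_ofReal_ne_top_iff_integrable hpm.aestronglyMeasurable (ae_of_all _ hp0)).2 hIp
  filter_upwards [hae] with v hv
  have := (ENNReal.ofReal_eq_ofReal_iff (hp0 v) (hm0 v)).1 hv
  rw [Pi.zero_apply, ← hsub v, this, sub_self]

/-! ### Density in `L²(ν)` -/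

/-- The trigonometric functions `cos(t·v)`, `sin(t·v)` are in `L²` of a finite measure. [cite: Janson1997, Thm 2.6 (proof)] -/
theorem memLp_two_trig (ν : Measure (J → ℝ)) [IsFiniteMeasure ν] (t : J → ℝ) (b : Bool) :
    MemLp (fun v : J → ℝ => if b then Real.cos (∑ j, t j * v j) else Real.sin (∑ j, t j * v j)) 2 ν := by
  refine MemLp.of_bound (C := 1) ?_ (ae_of_all _ fun v => ?_)
  · cases b
    · exact (Real.continuous_sin.comp (continuous_finsetSum _ fun j _ => continuous_const.mul (continuous_apply j))).aestronglyMeasurable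
    · exact (Real.continuous_cos.comp (continuous_finsetSum _ fun j _ => continuous_const.mul (continuous_apply j))).aestronglyMeasurable
  · cases b
    · simpa using Real.abs_sin_le_one _
    · simpa using Real.abs_cos_le_one _

omit [Fintype J] in
/-- A finite linear combination of `L²` elements `toLp f_a` is `toLp` of the combination of the functions. [folklore] -/
private theorem sum_smul_toLp_eq {α : Type*} {ν : Measure (J → ℝ)} (t : Finset α) (c : α → ℝ) (F : α → (J → ℝ) → ℝ) (hF : ∀ a, MemLp (F a) 2 ν) :
    ∑ a ∈ t, c a • (hF a).toLp (F a) = (memLp_finsetSum' t fun a _ => (hF a).const_smul (c a)).toLp (∑ a ∈ t, c a • F a) := by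
  classical
  induction t using Finset.induction_on with
  | empty => simp
  | insert a t hat ih =>
    rw [Finset.sum_insert hat, ih, ← MemLp.toLp_const_smul, ← MemLp.toLp_add]
    exact MemLp.toLp_congr _ _ (ae_of_all _ fun v => by
      simp only [Pi.add_apply, Pi.smul_apply, Finset.sum_apply, Finset.sum_insert hat])

/-- ★★ **TRIGONOMETRIC POLYNOMIALS ARE DENSE IN `L²` OF A FINITE MEASURE ON `ℝ^J`**: for `g ∈ L²(ν)` and `ε > 0` there are finitely many frequencies `t_k ∈ ℝ^J` and real
coefficients `α_k, β_k` with `‖g − Σ_k (α_k cos(Σ_j t_{kj}v_j) + β_k sin(Σ_j t_{kj}v_j))‖_{L²(ν)} < ε`.  (Orthogonal complement of their span `= ⊥` by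
`ae_eq_zero_of_forall_integral_mul_cos_sin_eq_zero`, hence dense in the Hilbert space `L²(ν)`.) [cite: Janson1997, Thm 2.6 (proof), Thm 2.11] [cite: GlimmJaffe1987, §6.1 (𝓔)] -/
theorem exists_trigPoly_sub_eLpNorm_lt {ν : Measure (J → ℝ)} [IsFiniteMeasure ν] {g : (J → ℝ) → ℝ} (hg : MemLp g 2 ν) {ε : ℝ} (hε : 0 < ε) :
    ∃ (n : ℕ) (t : Fin n → J → ℝ) (α β : Fin n → ℝ),
      eLpNorm (fun v => g v - ∑ k, (α k * Real.cos (∑ j, t k j * v j) + β k * Real.sin (∑ j, t k j * v j))) 2 ν < ENNReal.ofReal ε := by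
  classical
  -- the generating family in the Hilbert space `L²(ν)`
  set gen : (J → ℝ) × Bool → Lp ℝ 2 ν := fun p => (memLp_two_trig ν p.1 p.2).toLp _ with hgen
  set V : Submodule ℝ (Lp ℝ 2 ν) := Submodule.span ℝ (Set.range gen) with hV
  -- its orthogonal complement is trivial
  have hperp : Vᗮ = ⊥ := by
    rw [Submodule.eq_bot_iff]
    intro u hu
    have horth : ∀ p, ⟪gen p, u⟫_ℝ = 0 := fun p =>
      Submodule.inner_right_of_mem_orthogonal (Submodule.subset_span (Set.mem_range_self p)) hu
    have hint : ∀ (t : J → ℝ) (b : Bool), ∫ v, u v * (if b then Real.cos (∑ j, t j * v j) else Real.sin (∑ j, t j * v j)) ∂ν = 0 := by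
      intro t b
      have h := horth (t, b)
      rw [MeasureTheory.L2.inner_def] at h
      rw [← h]
      refine integral_congr_ae ?_
      filter_upwards [MemLp.coeFn_toLp (memLp_two_trig ν t b)] with v hv
      simp only [hgen]
      rw [hv]
      simp [mul_comm]
    have hae := ae_eq_zero_of_forall_integral_mul_cos_sin_eq_zero (ν := ν) (Lp.stronglyMeasurable u).measurable ((Lp.memLp u).integrable one_le_two)
      (fun t => by simpa using hint t true) (fun t => by simpa using hint t false)
    exact Lp.eq_zero_iff_ae_eq_zero.2 hae
  have hdense : V.topologicalClosure = ⊤ := Submodule.topologicalClosure_eq_top_iff.2 hperp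
  -- approximate `g`
  set G : Lp ℝ 2 ν := hg.toLp g with hG
  have hGmem : G ∈ V.topologicalClosure := by rw [hdense]; trivial
  rw [← SetLike.mem_coe, Submodule.topologicalClosure_coe, Metric.mem_closure_iff] at hGmem
  obtain ⟨y, hy, hdist⟩ := hGmem ε hε
  rw [SetLike.mem_coe, hV, Submodule.mem_span_iff_exists_finset_subset] at hy
  obtain ⟨c, T, hTS, -, rfl⟩ := hy
  -- choose generator parameters for the elements of `T`
  have hchoice : ∀ a : ↥T, ∃ p : (J → ℝ) × Bool, gen p = (a : Lp ℝ 2 ν) := fun a => hTS a.2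
  choose p hp using hchoice
  set n := T.card with hn
  set e : ↥T ≃ Fin n := T.equivFin with he
  refine ⟨n, fun k => (p (e.symm k)).1, fun k => if (p (e.symm k)).2 then c (e.symm k : Lp ℝ 2 ν) else 0,
    fun k => if (p (e.symm k)).2 then 0 else c (e.symm k : Lp ℝ 2 ν), ?_⟩
  -- the chosen combination, as a function
  set F : ↥T → (J → ℝ) → ℝ := fun a v => if (p a).2 then Real.cos (∑ j, (p a).1 j * v j) else Real.sin (∑ j, (p a).1 j * v j) with hF
  have hFmem : ∀ a : ↥T, MemLp (F a) 2 ν := fun a => memLp_two_trig ν (p a).1 (p a).2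
  have hsumT : ∑ a ∈ T, c a • a = ∑ a : ↥T, c (a : Lp ℝ 2 ν) • (hFmem a).toLp (F a) := by
    rw [← Finset.sum_coe_sort T]
    refine Finset.sum_congr rfl fun a _ => ?_
    rw [← hp a]
  have hcomb : ∑ a : ↥T, c (a : Lp ℝ 2 ν) • (hFmem a).toLp (F a)
      = (memLp_finsetSum' Finset.univ fun a _ => (hFmem a).const_smul (c (a : Lp ℝ 2 ν))).toLp (∑ a : ↥T, c (a : Lp ℝ 2 ν) • F a) :=
    sum_smul_toLp_eq Finset.univ (fun a : ↥T => c (a : Lp ℝ 2 ν)) F hFmem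
  have hPfun : (fun v => ∑ k : Fin n, ((if (p (e.symm k)).2 then c (e.symm k : Lp ℝ 2 ν) else 0) * Real.cos (∑ j, (p (e.symm k)).1 j * v j)
        + (if (p (e.symm k)).2 then 0 else c (e.symm k : Lp ℝ 2 ν)) * Real.sin (∑ j, (p (e.symm k)).1 j * v j)))
      = ∑ a : ↥T, c (a : Lp ℝ 2 ν) • F a := by
    funext v
    rw [Finset.sum_apply]
    rw [← e.symm.sum_comp]
    refine Finset.sum_congr rfl fun k _ => ?_
    simp only [hF, Pi.smul_apply, smul_eq_mul]
    split_ifs <;> ring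
  have hPmem : MemLp (∑ a : ↥T, c (a : Lp ℝ 2 ν) • F a) 2 ν := memLp_finsetSum' Finset.univ fun a _ => (hFmem a).const_smul (c (a : Lp ℝ 2 ν))
  have hsub : G - ∑ a ∈ T, c a • a = (hg.sub hPmem).toLp (g - ∑ a : ↥T, c (a : Lp ℝ 2 ν) • F a) := by
    rw [hsumT, hcomb, hG, MemLp.toLp_sub]
  have hnorm : dist G (∑ a ∈ T, c a • a) = (eLpNorm (g - ∑ a : ↥T, c (a : Lp ℝ 2 ν) • F a) 2 ν).toReal := by
    rw [dist_eq_norm, hsub, Lp.norm_toLp]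
  rw [hnorm] at hdist
  have hne : eLpNorm (g - ∑ a : ↥T, c (a : Lp ℝ 2 ν) • F a) 2 ν ≠ ⊤ := (hg.sub hPmem).eLpNorm_ne_top
  have hfin := (ENNReal.lt_ofReal_iff_toReal_lt hne).2 hdist
  have efun : (fun v => g v - ∑ k : Fin n, ((if (p (e.symm k)).2 then c (e.symm k : Lp ℝ 2 ν) else 0) * Real.cos (∑ j, (p (e.symm k)).1 j * v j)
        + (if (p (e.symm k)).2 then 0 else c (e.symm k : Lp ℝ 2 ν)) * Real.sin (∑ j, (p (e.symm k)).1 j * v j)))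
      = g - ∑ a : ↥T, c (a : Lp ℝ 2 ν) • F a := by
    rw [← hPfun]; rfl
  rw [efun]
  exact hfin

end

end Literature.Probability.Distributions
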